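import Summits.CriticalPhenomena.PercolationContinuityZ3.Theorems.PercNearOneGluingNoHeavyLowerTailSahiOneStepProfileGridPrelim
import HarnessLib

/-!
# Profile grid, the coupling: low/high parts of the block laws, the status vector `θ`, the coupled count `W`, marginals

Prover prim-ineq-prove-3 gen 44 (`--supports stmt-CriticalPhenomena-4575`).  Second of four files (see `…ProfileGridPrelim`).

For block laws `φ_j` on `{0,…,N}` and thresholds `r_j` put `lo_j = φ_j·1[< r_j]` (`loW`), `hi_j = φ_j·1[≥ r_j]` (`hiW`),
`d_j = Σ lo_j` (`loMass`).  The COUPLING SPACE is `(θ, ñ)` with `θ : κ → Fin (N+2)` (status: `θ_j = 0` = block low, weight `d_j`;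
`θ_j = c+1` = block high with count `c`, weight `hi_j(c)`: `thetaW`, product `rho`) and `ñ : κ → Fin (N+1)` the low sample (product weight
`Π lo_j`).  The COUPLED COUNT is `W_j = max(θ_j − 1, ñ_j)` (`cpl`; `= θ_j − 1` on high blocks and `ñ_j` on low blocks on the support,
`cpl_eq_cplLow`), monotone in both arguments and `≥ ñ`.  Marginals: `W ∼ d·Φ` (`sum_rho_lo_cpl`, via the per-block push-forward
`sum_pair_cpl_eq`), `ñ ∼ Φ|_D` with `D = {∀ j, v_j < r_j}` (`sum_rho_lo_low`), `Φ(D) = Π d_j` (`sum_box_eq_prod_loMass`).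
Definitions are the objects of this proof only (reviewed asynchronously); no sorries.
-/

namespace Summit.CriticalPhenomena.PercolationContinuityZ3.Theorems

namespace SahiOneStep

namespace ProfileGrid

open Finset Function
open Literature.Probability.Distributions (IsLogConcaveSeq piWeight blockSum laySum laySum_def efron_prefix_mul_le)
open Literature.Probability.LatticeModels.FKGEqualityChains (mix IsLogSupermodular cov cov_nonneg)
open Literature.Combinatorics.Sahi2008 (ex)

variable {κ : Type*} {N : ℕ}

/-! ## The coupling space: low parts, high parts, the `θ`-weights and the coupled count -/

/-- Low part of the block law: `φ_j` restricted to `{n < r_j}` (block `j` does not fire). [this work] -/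
def loW (φ : κ → ℕ → ℝ) (r : κ → ℕ) (j : κ) (n : ℕ) : ℝ := if n < r j then φ j n else 0

/-- High part of the block law: `φ_j` restricted to `{r_j ≤ n}` (block `j` fires). [this work] -/
def hiW (φ : κ → ℕ → ℝ) (r : κ → ℕ) (j : κ) (n : ℕ) : ℝ := if r j ≤ n then φ j n else 0

/-- The low mass `d_j = Σ_{n ≤ N} lo_j(n)` of block `j`. [this work] -/
def loMass (N : ℕ) (φ : κ → ℕ → ℝ) (r : κ → ℕ) (j : κ) : ℝ := ∑ n : Fin (N + 1), loW φ r j n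

/-- The weight of the status variable `θ_j ∈ {0,…,N+1}` of block `j`: `θ_j = 0` ("low") has weight `d_j`, `θ_j = c+1`
("high with count `c`") has weight `hi_j(c)`. [this work] -/
def thetaW (N : ℕ) (φ : κ → ℕ → ℝ) (r : κ → ℕ) (j : κ) (c : Fin (N + 2)) : ℝ :=
  if (c : ℕ) = 0 then loMass N φ r j else hiW φ r j ((c : ℕ) - 1)

/-- One coordinate of the coupled count: `max(c − 1, n)` for a status `c ∈ {0,…,N+1}` and a low sample `n ≤ N`. [this work] -/
def cplFin (c : Fin (N + 2)) (n : Fin (N + 1)) : Fin (N + 1) :=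
  ⟨max ((c : ℕ) - 1) (n : ℕ), max_lt (by have := c.2; omega) n.2⟩

/-- Value of `cplFin`. [this work] -/
@[simp] theorem cplFin_val (c : Fin (N + 2)) (n : Fin (N + 1)) : (cplFin c n : ℕ) = max ((c : ℕ) - 1) (n : ℕ) := rfl

/-- The coupled count `W_j = max(θ_j − 1, ñ_j)`: the high count if block `j` is high, the low sample `ñ_j` otherwise
(the `max` makes `W` monotone in both arguments everywhere; on the support it is the case distinction). [this work] -/
def cpl (θ : κ → Fin (N + 2)) (ñ : κ → Fin (N + 1)) : κ → Fin (N + 1) := fun j => cplFin (θ j) (ñ j)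

/-- Value of `cpl`. [this work] -/
@[simp] theorem cpl_val (θ : κ → Fin (N + 2)) (ñ : κ → Fin (N + 1)) (j : κ) :
    (cpl θ ñ j : ℕ) = max ((θ j : ℕ) - 1) (ñ j : ℕ) := rfl

/-- The case-distinction form of the coupled count: `ñ_j` on low blocks, `θ_j − 1` on high blocks. [this work] -/
def cplLow (θ : κ → Fin (N + 2)) (ñ : κ → Fin (N + 1)) : κ → Fin (N + 1) := fun j =>
  if (θ j : ℕ) = 0 then ñ j else ⟨(θ j : ℕ) - 1, by have := (θ j).2; omega⟩

/-- Value of `cplLow`. [this work] -/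
theorem cplLow_val (θ : κ → Fin (N + 2)) (ñ : κ → Fin (N + 1)) (j : κ) :
    (cplLow θ ñ j : ℕ) = if (θ j : ℕ) = 0 then (ñ j : ℕ) else (θ j : ℕ) - 1 := by
  unfold cplLow; split_ifs <;> rfl

section Basic

variable (φ : κ → ℕ → ℝ) (r : κ → ℕ)

/-- `lo + hi = φ`. [this work] -/
theorem loW_add_hiW (j : κ) (n : ℕ) : loW φ r j n + hiW φ r j n = φ j n := by
  unfold loW hiW; by_cases h : n < r j
  · rw [if_pos h, if_neg (by omega), add_zero]
  · rw [if_neg h, if_pos (by omega), zero_add]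

/-- `lo ≥ 0`. [this work] -/
theorem loW_nonneg (hφ0 : ∀ j n, 0 ≤ φ j n) (j : κ) (n : ℕ) : 0 ≤ loW φ r j n := by
  unfold loW; split_ifs <;> [exact hφ0 j n; exact le_rfl]

/-- `hi ≥ 0`. [this work] -/
theorem hiW_nonneg (hφ0 : ∀ j n, 0 ≤ φ j n) (j : κ) (n : ℕ) : 0 ≤ hiW φ r j n := by
  unfold hiW; split_ifs <;> [exact hφ0 j n; exact le_rfl]

/-- Support of `lo`. [this work] -/
theorem lt_of_loW_ne_zero {j : κ} {n : ℕ} (h : loW φ r j n ≠ 0) : n < r j := by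
  unfold loW at h; by_contra h'; exact h (if_neg h')

/-- Support of `hi`. [this work] -/
theorem le_of_hiW_ne_zero {j : κ} {n : ℕ} (h : hiW φ r j n ≠ 0) : r j ≤ n := by
  unfold hiW at h; by_contra h'; exact h (if_neg h')

/-- `lo_j` is `PF₂` when `φ_j` is. [this work] -/
theorem isLogConcaveSeq_loW (hφ : ∀ j, IsLogConcaveSeq (φ j)) (j : κ) : IsLogConcaveSeq (loW φ r j) :=
  (hφ j).truncLT (r j)

/-- `d_j ≥ 0`. [this work] -/
theorem loMass_nonneg (hφ0 : ∀ j n, 0 ≤ φ j n) (j : κ) : 0 ≤ loMass N φ r j :=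
  sum_nonneg fun n _ => loW_nonneg φ r hφ0 j n

/-- `θ`-weights are nonnegative. [this work] -/
theorem thetaW_nonneg (hφ0 : ∀ j n, 0 ≤ φ j n) (j : κ) (c : Fin (N + 2)) : 0 ≤ thetaW N φ r j c := by
  unfold thetaW; split_ifs <;> [exact loMass_nonneg φ r hφ0 j; exact hiW_nonneg φ r hφ0 j _]

/-- Total `θ`-weight of a block = total mass of `φ_j` on `{0,…,N}`. [this work] -/
theorem sum_thetaW (j : κ) : ∑ c : Fin (N + 2), thetaW N φ r j c = ∑ n : Fin (N + 1), φ j n := by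
  rw [Fin.sum_univ_succ]
  simp only [thetaW, Fin.val_zero, if_true, Fin.val_succ, Nat.succ_ne_zero, if_false, Nat.add_sub_cancel, loMass,
    ← sum_add_distrib, loW_add_hiW]

end Basic

section Rho

variable [Fintype κ] (φ : κ → ℕ → ℝ) (r : κ → ℕ)

/-- The product `θ`-weight. [this work] -/
def rho (N : ℕ) (φ : κ → ℕ → ℝ) (r : κ → ℕ) (θ : κ → Fin (N + 2)) : ℝ := ∏ j, thetaW N φ r j (θ j)

/-- `ρ ≥ 0`. [this work] -/
theorem rho_nonneg (hφ0 : ∀ j n, 0 ≤ φ j n) (θ : κ → Fin (N + 2)) : 0 ≤ rho N φ r θ :=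
  prod_nonneg fun j _ => thetaW_nonneg φ r hφ0 j _

/-- `Σ_θ ρ(θ) = Π_j Σ_n φ_j(n)` (`= 1` for normalised block laws). [this work] -/
theorem sum_rho [DecidableEq κ] : ∑ θ : κ → Fin (N + 2), rho N φ r θ = ∏ j, ∑ n : Fin (N + 1), φ j n := by
  unfold rho; rw [← Fintype.prod_sum]; exact prod_congr rfl fun j _ => sum_thetaW φ r j

/-- On the support of `ρ`, a nonzero status `θ_j = c + 1` has `r_j ≤ c`. [this work] -/
theorem le_pred_of_rho_ne_zero {θ : κ → Fin (N + 2)} (h : rho N φ r θ ≠ 0) {j : κ} (hj : (θ j : ℕ) ≠ 0) :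
    r j ≤ (θ j : ℕ) - 1 := by
  have : thetaW N φ r j (θ j) ≠ 0 := fun h0 => h (prod_eq_zero (mem_univ j) h0)
  unfold thetaW at this; rw [if_neg hj] at this
  exact le_of_hiW_ne_zero φ r this

/-- On the support of the low product weight every coordinate is below its threshold. [this work] -/
theorem lt_of_piWeight_loW_ne_zero {ñ : κ → Fin (N + 1)} (h : piWeight N (loW φ r) ñ ≠ 0) (j : κ) : (ñ j : ℕ) < r j := by
  have : loW φ r j (ñ j) ≠ 0 := fun h0 => h (prod_eq_zero (mem_univ j) h0)
  exact lt_of_loW_ne_zero φ r this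

/-- The low product weight is the block law restricted to the box `D = {∀ j, v_j < r_j}`. [this work] -/
theorem piWeight_loW_eq (v : κ → Fin (N + 1)) :
    piWeight N (loW φ r) v = if ∀ j, (v j : ℕ) < r j then piWeight N φ v else 0 := by
  unfold piWeight loW; exact Fintype.prod_ite_zero

end Rho

/-! ## The coupled count: monotonicity and support -/

/-- `ñ ≤ W(θ, ñ)`. [this work] -/
theorem le_cpl (θ : κ → Fin (N + 2)) (ñ : κ → Fin (N + 1)) : ñ ≤ cpl θ ñ := fun j => by
  rw [Fin.le_iff_val_le_val, cpl_val]; exact le_max_right _ _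

/-- `W` is monotone in `θ`. [this work] -/
theorem cpl_mono_left {θ θ' : κ → Fin (N + 2)} (h : θ ≤ θ') (ñ : κ → Fin (N + 1)) : cpl θ ñ ≤ cpl θ' ñ := fun j => by
  rw [Fin.le_iff_val_le_val, cpl_val, cpl_val]
  have : (θ j : ℕ) ≤ (θ' j : ℕ) := h j
  exact max_le_max (by omega) le_rfl

/-- `W` is monotone in `ñ`. [this work] -/
theorem cpl_mono_right (θ : κ → Fin (N + 2)) {ñ ñ' : κ → Fin (N + 1)} (h : ñ ≤ ñ') : cpl θ ñ ≤ cpl θ ñ' := fun j => by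
  rw [Fin.le_iff_val_le_val, cpl_val, cpl_val]
  have : (ñ j : ℕ) ≤ (ñ' j : ℕ) := h j
  exact max_le_max le_rfl this

/-- `W_low` is monotone in `ñ`. [this work] -/
theorem cplLow_mono_right (θ : κ → Fin (N + 2)) {ñ ñ' : κ → Fin (N + 1)} (h : ñ ≤ ñ') : cplLow θ ñ ≤ cplLow θ ñ' :=
  fun j => by
    rw [Fin.le_iff_val_le_val, cplLow_val, cplLow_val]
    split_ifs
    · exact h j
    · exact le_rfl

/-- On the support (`ñ_j < r_j ≤ θ_j − 1` on high blocks) the two forms of the coupled count agree. [this work] -/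
theorem cpl_eq_cplLow {r : κ → ℕ} {θ : κ → Fin (N + 2)} {ñ : κ → Fin (N + 1)} (hñ : ∀ j, (ñ j : ℕ) < r j)
    (hθ : ∀ j, (θ j : ℕ) ≠ 0 → r j ≤ (θ j : ℕ) - 1) : cpl θ ñ = cplLow θ ñ := by
  funext j
  apply Fin.ext
  rw [cpl_val, cplLow_val]
  by_cases h0 : (θ j : ℕ) = 0
  · rw [if_pos h0, h0]; simp
  · rw [if_neg h0]
    have := hθ j h0; have := hñ j
    exact max_eq_left (by omega)

/-- `W_low` does not depend on the low samples of the HIGH blocks: it is determined by the coordinates in the low set. [this work] -/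
theorem cplLow_mix [Fintype κ] (θ : κ → Fin (N + 2)) (x β : κ → Fin (N + 1)) :
    cplLow θ (mix (↑(univ.filter fun j => (θ j : ℕ) = 0) : Set κ) x β) = cplLow θ x := by
  funext j
  unfold cplLow mix
  by_cases h0 : (θ j : ℕ) = 0
  · rw [if_pos h0, if_pos h0, if_pos (show j ∈ (↑(univ.filter fun j => (θ j : ℕ) = 0) : Set κ) from by
      rw [Finset.mem_coe, Finset.mem_filter]; exact ⟨mem_univ j, h0⟩)]
  · rw [if_neg h0, if_neg h0]

/-! ## Marginals of the coupling -/

section Marginals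

variable [Fintype κ] [DecidableEq κ]

omit [Fintype κ] [DecidableEq κ] in
/-- **Per-block push-forward**: the law of `W_j = max(θ_j − 1, ñ_j)` under `θ_j ∼ thetaW_j`, `ñ_j ∼ lo_j` (independent) is `d_j · φ_j`.
[this work] -/
theorem sum_pair_cpl_eq (φ : κ → ℕ → ℝ) (r : κ → ℕ) (j : κ) (v : Fin (N + 1)) :
    ∑ a : Fin (N + 2) × Fin (N + 1), (if cplFin a.1 a.2 = v then thetaW N φ r j a.1 * loW φ r j a.2 else 0) =
      loMass N φ r j * φ j v := by
  rw [Fintype.sum_prod_type, Fin.sum_univ_succ]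
  -- `θ_j = 0`: `W_j = ñ_j`
  have h0 : ∑ n : Fin (N + 1), (if cplFin (0 : Fin (N + 2)) n = v then thetaW N φ r j 0 * loW φ r j n else 0) =
      loMass N φ r j * loW φ r j v := by
    have e : ∀ n : Fin (N + 1), cplFin (0 : Fin (N + 2)) n = n := fun n => Fin.ext (by simp)
    simp only [e, Fintype.sum_ite_eq', thetaW, Fin.val_zero, if_true]
  -- `θ_j = m + 1`: `W_j = max(m, ñ_j) = m` on the support
  have h1 : ∀ m : Fin (N + 1), ∑ n : Fin (N + 1), (if cplFin m.succ n = v then thetaW N φ r j m.succ * loW φ r j n else 0) =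
      (if m = v then hiW φ r j m * loMass N φ r j else 0) := by
    intro m
    have hθ : thetaW N φ r j m.succ = hiW φ r j m := by simp [thetaW]
    simp only [hθ]
    by_cases hm : m = v
    · rw [if_pos hm, loMass, mul_sum]
      refine sum_congr rfl fun n _ => ?_
      by_cases hz : hiW φ r j m * loW φ r j n = 0
      · rw [hz]; split_ifs <;> rfl
      · have hn : (n : ℕ) < r j := lt_of_loW_ne_zero φ r (fun h => hz (by rw [h, mul_zero]))
        have hm' : r j ≤ (m : ℕ) := le_of_hiW_ne_zero φ r (fun h => hz (by rw [h, zero_mul]))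
        rw [if_pos]
        apply Fin.ext; rw [cplFin_val, Fin.val_succ, ← hm]; simp; omega
    · rw [if_neg hm]
      refine sum_eq_zero fun n _ => ?_
      by_cases hz : hiW φ r j m * loW φ r j n = 0
      · rw [hz]; split_ifs <;> rfl
      · have hn : (n : ℕ) < r j := lt_of_loW_ne_zero φ r (fun h => hz (by rw [h, mul_zero]))
        have hm' : r j ≤ (m : ℕ) := le_of_hiW_ne_zero φ r (fun h => hz (by rw [h, zero_mul]))
        rw [if_neg]
        intro h; apply hm; apply Fin.ext
        have := congr_arg Fin.val h; simp at this; omega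
  rw [h0, Fintype.sum_congr _ _ h1, Fintype.sum_ite_eq', ← loW_add_hiW φ r j v]
  ring

/-- **Marginal of the coupled count**: `E[g(W)] = d · Σ_v Φ(v) g(v)` with `d = Π_j d_j`. [this work] -/
theorem sum_rho_lo_cpl (φ : κ → ℕ → ℝ) (r : κ → ℕ) (g : (κ → Fin (N + 1)) → ℝ) :
    ∑ θ : κ → Fin (N + 2), ∑ ñ : κ → Fin (N + 1), rho N φ r θ * piWeight N (loW φ r) ñ * g (cpl θ ñ) =
      (∏ j, loMass N φ r j) * ∑ v : κ → Fin (N + 1), piWeight N φ v * g v := by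
  -- pass to configurations of pairs
  have e1 : ∑ θ : κ → Fin (N + 2), ∑ ñ : κ → Fin (N + 1), rho N φ r θ * piWeight N (loW φ r) ñ * g (cpl θ ñ) =
      ∑ c : κ → Fin (N + 2) × Fin (N + 1), (∏ j, thetaW N φ r j (c j).1 * loW φ r j (c j).2) *
        g (fun j => cplFin (c j).1 (c j).2) := by
    rw [← Fintype.sum_prod_type', ← Equiv.sum_comp (Equiv.arrowProdEquivProdArrow κ (fun _ => Fin (N + 2)) fun _ => Fin (N + 1))]
    refine Fintype.sum_congr _ _ fun c => ?_
    simp only [Equiv.arrowProdEquivProdArrow, Equiv.coe_fn_mk, rho, piWeight, prod_mul_distrib]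
    rfl
  rw [e1, sum_prod_mul_comp_eq (fun j (a : Fin (N + 2) × Fin (N + 1)) => thetaW N φ r j a.1 * loW φ r j a.2)
    (fun _ (a : Fin (N + 2) × Fin (N + 1)) => cplFin a.1 a.2) g, mul_sum]
  refine Fintype.sum_congr _ _ fun v => ?_
  rw [prod_congr rfl fun j _ => sum_pair_cpl_eq φ r j (v j), prod_mul_distrib, piWeight]
  ring

/-- **Marginal of the low sample**: `E[k(ñ)] = (Σ ρ) · Σ_{v ∈ D} Φ(v) k(v)`. [this work] -/
theorem sum_rho_lo_low (φ : κ → ℕ → ℝ) (r : κ → ℕ) (k : (κ → Fin (N + 1)) → ℝ) :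
    ∑ θ : κ → Fin (N + 2), ∑ ñ : κ → Fin (N + 1), rho N φ r θ * piWeight N (loW φ r) ñ * k ñ =
      (∏ j, ∑ n : Fin (N + 1), φ j n) * ∑ v : κ → Fin (N + 1), (if ∀ j, (v j : ℕ) < r j then piWeight N φ v * k v else 0) := by
  rw [← sum_rho φ r, sum_mul_sum]
  refine Fintype.sum_congr _ _ fun θ => Fintype.sum_congr _ _ fun ñ => ?_
  rw [piWeight_loW_eq]; split_ifs <;> ring

/-- The mass of the box `D`: `Σ_{v ∈ D} Φ(v) = Π_j d_j`. [this work] -/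
theorem sum_box_eq_prod_loMass (φ : κ → ℕ → ℝ) (r : κ → ℕ) :
    ∑ v : κ → Fin (N + 1), (if ∀ j, (v j : ℕ) < r j then piWeight N φ v else 0) = ∏ j, loMass N φ r j := by
  unfold loMass; rw [Fintype.prod_sum]
  refine Fintype.sum_congr _ _ fun v => ?_
  rw [← piWeight_loW_eq φ r v]; rfl

end Marginals

end ProfileGrid

end SahiOneStep

end Summit.CriticalPhenomena.PercolationContinuityZ3.Theorems
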